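import Mathlib
import Summits.ValiantsHypothesis.ValiantsHypothesis.Theses.ValuativeGCT
import Summits.ValiantsHypothesis.ValiantsHypothesis.Theorems.TailFlip.Negative.TailFlipLoadBearing
import Summits.ValiantsHypothesis.ValiantsHypothesis.Theorems.ValuativeGCTValuativeFlipHeadSqrtTwo
import Summits.ValiantsHypothesis.ValiantsHypothesis.Theorems.ValuativeGCTValuativeFlipFourRowMethodBoundary
import HarnessLib

/-!
# `SlopeTwoHead` ladder — the SPECIAL CASE already a theorem (F3 witness), self-contained

Rung (filed in `Lines/doubled_kronecker_deficit.lean`):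
`SlopeTwoHead : ∃ n₀, ∀ n ≥ n₀, ∀ m, n ≤ m → 1 * m ≤ 2 * n → FlipAt n m` (slope `2`).

Witness of weakness / floor: the same statement at every slope `a/b < √2` is LANDED in the tree
(`Theorems/ValuativeGCTValuativeFlipHeadSqrtTwo.lean`, four-row tangent-pencil count), restated here over
the verbatim crux body `FlipAt`; the named instance is slope `7/5`.  The method ceiling separating the
floor from the rung is `fourRow_rankHyp_unsat` (`Theorems/ValuativeGCTValuativeFlipFourRowMethodBoundary.lean`):
the four-row inequality system has no solution once `2n² + 2 ≤ m²`, so no slope `≥ √2` — in particular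
not the rung's slope `2` — is reachable by that count.
-/

namespace Summit.ValiantsHypothesis.ValiantsHypothesis.Cruxes.TailFlip.SlopeTwoHead.Special

open Literature.NumberTheory.DiophantineGeometry Literature.Computability.AlgebraicComplexity
open Summit.ValiantsHypothesis.ValiantsHypothesis.Theorems.TailFlip.Negative
open Summit.ValiantsHypothesis.ValiantsHypothesis.Theorems.ValuativeFlip

/-- **F3 witness family**: every slope `a/b` with `a² < 2b²`. [tree: `headFlipBody_of_sq_lt_two`] -/
theorem slopeHead_of_sq_lt_two (a b : ℕ) (hb : 0 < b) (hab : a ^ 2 < 2 * b ^ 2) :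
    ∃ n₀ : ℕ, ∀ n ≥ n₀, ∀ (m : ℕ) [NeZero m], n ≤ m → b * m ≤ a * n → FlipAt n m :=
  headFlipBody_of_sq_lt_two a b hb hab

/-- **F3 witness, named instance**: slope `7/5`. [tree: `headFlipBody_seven_fifths`] -/
theorem slopeHead_seven_fifths :
    ∃ n₀ : ℕ, ∀ n ≥ n₀, ∀ (m : ℕ) [NeZero m], n ≤ m → 5 * m ≤ 7 * n → FlipAt n m :=
  headFlipBody_seven_fifths

/-- **The ceiling is a theorem** (method boundary of the floor's engine): whenever `2n² + 2 ≤ m²`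
(every slope `≥ √2`, in particular the rung's top level `m = 2n`, `n ≥ 1`) the four-row tangent-pencil
rank at `X₀₀^{m-n} per_n` is `< 2m² + m + 2`, so the four-row hypothesis system of
`headFlipBody_of_sq_lt_two` cannot be met. [tree: `fourRow_rankHyp_unsat`] -/
theorem fourRow_unsat_of_two_sq_le (n m : ℕ) [NeZero m] (hnm : n ≤ m) (hm : 2 * n ^ 2 + 2 ≤ m ^ 2)
    (g : GL (MatIdx m) ℂ) :
    Module.finrank ℂ ↥(Submodule.span ℂ (Set.range fun ab : {a : MatIdx m // m * m ≤ (((matIdxEquiv m).symm a : Fin (m * m)) : ℕ) + 4} × MatIdx m => (MvPolynomial.X ab.1.1 : MvPolynomial (MatIdx m) ℂ) * MvPolynomial.aeval (fun i : MatIdx m => if m * m ≤ (((matIdxEquiv m).symm i : Fin (m * m)) : ℕ) + 4 then (MvPolynomial.X i : MvPolynomial (MatIdx m) ℂ) else 0) (MvPolynomial.pderiv ab.2 (linSubst (MatIdx m) ℂ ((g : GL (MatIdx m) ℂ) : Matrix (MatIdx m) (MatIdx m) ℂ) (paddedPerFormLex ℂ n m))))) <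
      2 * m ^ 2 + m + 2 :=
  fourRow_rankHyp_unsat n m hnm hm g

/-- At the doubling level the ceiling hypothesis holds: `2n² + 2 ≤ (2n)²` for `n ≥ 1`. -/
theorem two_sq_add_two_le_doubling_sq (n : ℕ) (hn : 1 ≤ n) : 2 * n ^ 2 + 2 ≤ (2 * n) ^ 2 := by
  nlinarith

end Summit.ValiantsHypothesis.ValiantsHypothesis.Cruxes.TailFlip.SlopeTwoHead.Special
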